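import Literature.MathematicalPhysics.QuantumLattice.DWaveSourceFreePressure
import Literature.MathematicalPhysics.QuantumLattice.OnSitePairingQuasiparticles
import HarnessLib

/-!
# The `U = 0` d-wave-sourced torus: the Bogoliubov KKT rows pin the pair amplitude EXACTLY

Topic `MathematicalPhysics/QuantumLattice` (family `hubbard`; cell `hubbard-cq`, card
`sourced-kkt-one-point-floor`, calibration «kkt-u0-bogoliubov-exactness», the Lean twin of dual-2's
TOY-k1 column «full range = 1.0000»). The free sourced torus
`A = dWaveSourceTorus L 0 μ s = H(1,0) - μN - s(Δ_d + Δ_dᴴ)` is, in momentum space,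
`Σ_k [ξ_k(n_{k↑} + n_{k↓}) + D_k(b_k + b_kᴴ)]`, `ξ_k = ε_L(k) - μ`, `D_k = 2√2 s ĝ_d(k)`, `b_k = c_{-k↓}c_{k↑}`
(`dWaveSourceTorus_zero_eq_sum`), conjugate by the tree's Bogoliubov implementer `W` to a sum of ON-SITE
BdG blocks (`exists_bdg_implementer`, `DWaveSourceFreePressure.lean`). Given Bogoliubov data
`(u_k, v_k, E_k)` — `u_k² + v_k² = 1`, `D_k v_k = (E_k - ξ_k)u_k`, `D_k u_k = (E_k + ξ_k)v_k` (they exist,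
`exists_bogoliubov_uv`, `E_k = √(ξ_k² + D_k²)`) — the MOMENTUM-SPACE QUASIPARTICLES

  `γ⁽¹⁾_k = u_k c_{k↑} + v_k c†_{-k↓}`,   `γ⁽²⁾_k = u_k c_{-k↓} - v_k c†_{k↑}`

are lowering modes of `A` (`dWaveSourceTorus_zero_comm_bdgModeUp/Down`: `Aγ - γA = -E_k γ`; transport of
`OnSitePairingQuasiparticles.bdgPair_comm_quasiparticleUp/Down` through `W`). MAIN THEOREM
(`trace_pairField_of_bdgRows`): if NO BdG energy vanishes (`E_k > 0` for all `k`: no zero mode), then for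
EVERY `ρ ⪰ 0` satisfying the second-order stationarity rows of these `2L²` modes,

  `0 ≤ Re Tr(ρ γ_kᴴ (Aγ_k - γ_kA))`   (all `k`, both families),

the sourced pair amplitude is PINNED: `Tr(ρ Δ_d) = 2√2 (Σ_k ĝ_d(k) u_k v_k) · Tr ρ` — the BCS value, with no
energy datum and no other row (`QuadraticKKTExactness.annihilate_of_rows` + the on-site pinned pair
amplitude `trace_pair_of_annihilate`). Every ground-state density matrix satisfies the rows
(`GibbsStationaritySlack.trace_mul_conjTranspose_comm_mul_nonneg`), so row-feasible states and ground
states agree on `Tr(· Δ_d)` (`trace_pairField_of_bdgRows_eq_groundState`): the KKT-certified one-point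
floor / ceiling of the sourced pair amplitude is EXACT at `U = 0` (census (9) scope of the cell; the
interacting case is the card's crux K1 and is NOT addressed). ZERO-MODE EDGE
(`trace_pairField_of_bdgRows_of_dWaveGap`, `dWaveSourceDensity_zero_eq_of_ne_zero`): rows and `E_k > 0` are needed
only where `ĝ_d(k) ≠ 0`, so for `s ≠ 0` no zero-mode hypothesis remains. COROLLARY (`dWaveSourceDensity_zero_eq`): the exact
free-gas response in closed form, `m_L(s) = L⁻² Σ_k 4sĝ_d(k)²/√((ε_L(k)-μ)² + 8s²ĝ_d(k)²)` (no zero mode). No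
definition and no named fact is introduced.

## References
* J. von Delft, D. C. Ralph, Phys. Rep. 345 (2001) 61, §4.2 [VondelftRalph2001] (BCS/BdG quasiparticles).
* P. G. de Gennes, *Superconductivity of Metals and Alloys* (1966), Ch. 5 [deGennes1966].
* V. Bach, E. H. Lieb, J. P. Solovej, J. Stat. Phys. 76 (1994) 3–89, §2 [BachLiebSolovej1994] (quasi-free
  states are fixed by their one-body words).
* M. Araújo et al., arXiv:2311.18707, §3.2 Prop. 11 [AraujoEtAl2023] (state-optimality / KKT rows).
-/

noncomputable section

namespace Literature.MathematicalPhysics.QuantumLattice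

open Matrix Finset Literature.Probability.LatticeModels HubbardWave0 LiebThm1
open scoped ComplexConjugate ComplexOrder

variable {L : ℕ} [NeZero L]

/-! ### Bookkeeping: orbitals of a site, locality of the on-site blocks -/

/-- **Locality**: a sum of on-site BdG blocks commutes with an operator of site `x` up to the block at `x`:
`(Σ_y h_y) q - q (Σ_y h_y) = h_x q - q h_x` for `q ∈ 𝔄({x})` (even blocks at `y ≠ x` commute with `q`,
`commute_of_mem_carEvenSubalgebra`). [cite: VondelftRalph2001, §4.2] -/
theorem sum_onSiteBdG_comm_eq_single {Λ : Type*} [LinearOrder Λ] [Fintype Λ] (ξ D : Λ → ℂ) (x : Λ)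
    {q : Matrix (Finset (Orb Λ)) (Finset (Orb Λ)) ℂ} (hq : q ∈ carSubalgebra (orbs ({x} : Finset Λ))) :
    (∑ y : Λ, (ξ y • (numberOp y 0 + numberOp y 1) +
        D y • (annihilation (orb y 1) * annihilation (orb y 0) +
          (annihilation (orb y 1) * annihilation (orb y 0))ᴴ))) * q -
      q * (∑ y : Λ, (ξ y • (numberOp y 0 + numberOp y 1) +
        D y • (annihilation (orb y 1) * annihilation (orb y 0) +
          (annihilation (orb y 1) * annihilation (orb y 0))ᴴ))) =
      (ξ x • (numberOp x 0 + numberOp x 1) +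
          D x • (annihilation (orb x 1) * annihilation (orb x 0) +
            (annihilation (orb x 1) * annihilation (orb x 0))ᴴ)) * q -
        q * (ξ x • (numberOp x 0 + numberOp x 1) +
          D x • (annihilation (orb x 1) * annihilation (orb x 0) +
            (annihilation (orb x 1) * annihilation (orb x 0))ᴴ)) := by
  rw [Finset.sum_mul, Finset.mul_sum, ← Finset.sum_sub_distrib]
  refine Finset.sum_eq_single x (fun y _ hyx => ?_) (fun h => absurd (Finset.mem_univ x) h)
  have hcomm : Commute (ξ y • (numberOp y 0 + numberOp y 1) +
      D y • (annihilation (orb y 1) * annihilation (orb y 0) +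
        (annihilation (orb y 1) * annihilation (orb y 0))ᴴ)) q :=
    commute_of_mem_carEvenSubalgebra (onSiteBdG_mem (A := ({y} : Finset Λ))
      (Finset.mem_singleton_self y) (ξ y) (D y)) hq
      (disjoint_orbs (Finset.disjoint_singleton.2 hyx))
  rw [hcomm.eq, sub_self]

/-- The two orbitals of a site are distinct. [folklore] -/
private theorem orb_zero_ne_one' {Λ : Type*} (x : Λ) : orb x 0 ≠ orb x 1 := fun h =>
  zero_ne_one (congrArg Prod.snd (toLex.injective h) : (0 : Fin 2) = 1)

/-- **The sum of on-site blocks lowers the first quasiparticle of site `x`**: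
`(Σ_y h_y) q₁ - q₁ (Σ_y h_y) = -E q₁`, `q₁ = u c_{x↑} + v c†_{x↓}`, under the Bogoliubov relations at `x`
(`bdgPair_comm_quasiparticleUp` + locality). [cite: VondelftRalph2001, §4.2] [cite: deGennes1966, Ch. 5] -/
theorem sum_onSiteBdG_comm_quasiparticleUp {Λ : Type*} [LinearOrder Λ] [Fintype Λ] (ξ D : Λ → ℝ)
    (x : Λ) {E u v : ℝ} (hu : D x * v = (E - ξ x) * u) (hv : D x * u = (E + ξ x) * v) :
    (∑ y : Λ, ((ξ y : ℂ) • (numberOp y 0 + numberOp y 1) +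
        (D y : ℂ) • (annihilation (orb y 1) * annihilation (orb y 0) +
          (annihilation (orb y 1) * annihilation (orb y 0))ᴴ))) *
        ((u : ℂ) • annihilation (orb x 0) + (v : ℂ) • creation (orb x 1)) -
      ((u : ℂ) • annihilation (orb x 0) + (v : ℂ) • creation (orb x 1)) *
        (∑ y : Λ, ((ξ y : ℂ) • (numberOp y 0 + numberOp y 1) +
          (D y : ℂ) • (annihilation (orb y 1) * annihilation (orb y 0) +
            (annihilation (orb y 1) * annihilation (orb y 0))ᴴ))) =
      -(E : ℂ) • ((u : ℂ) • annihilation (orb x 0) + (v : ℂ) • creation (orb x 1)) := by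
  have hmem : (u : ℂ) • annihilation (orb x 0) + (v : ℂ) • creation (orb x 1) ∈
      carSubalgebra (orbs ({x} : Finset Λ)) :=
    Subalgebra.add_mem _
      (Subalgebra.smul_mem _ (annihilation_mem_carSubalgebra (orb_mem_orbs.2 (Finset.mem_singleton_self x))) _)
      (Subalgebra.smul_mem _ (creation_mem_carSubalgebra (orb_mem_orbs.2 (Finset.mem_singleton_self x))) _)
  rw [sum_onSiteBdG_comm_eq_single (fun y => (ξ y : ℂ)) (fun y => (D y : ℂ)) x hmem]
  exact bdgPair_comm_quasiparticleUp (orb_zero_ne_one' x) hu hv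

/-- **The sum of on-site blocks lowers the second quasiparticle of site `x`**:
`(Σ_y h_y) q₂ - q₂ (Σ_y h_y) = -E q₂`, `q₂ = u c_{x↓} - v c†_{x↑}`. [cite: VondelftRalph2001, §4.2] [cite: deGennes1966, Ch. 5] -/
theorem sum_onSiteBdG_comm_quasiparticleDown {Λ : Type*} [LinearOrder Λ] [Fintype Λ] (ξ D : Λ → ℝ)
    (x : Λ) {E u v : ℝ} (hu : D x * v = (E - ξ x) * u) (hv : D x * u = (E + ξ x) * v) :
    (∑ y : Λ, ((ξ y : ℂ) • (numberOp y 0 + numberOp y 1) +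
        (D y : ℂ) • (annihilation (orb y 1) * annihilation (orb y 0) +
          (annihilation (orb y 1) * annihilation (orb y 0))ᴴ))) *
        ((u : ℂ) • annihilation (orb x 1) - (v : ℂ) • creation (orb x 0)) -
      ((u : ℂ) • annihilation (orb x 1) - (v : ℂ) • creation (orb x 0)) *
        (∑ y : Λ, ((ξ y : ℂ) • (numberOp y 0 + numberOp y 1) +
          (D y : ℂ) • (annihilation (orb y 1) * annihilation (orb y 0) +
            (annihilation (orb y 1) * annihilation (orb y 0))ᴴ))) =
      -(E : ℂ) • ((u : ℂ) • annihilation (orb x 1) - (v : ℂ) • creation (orb x 0)) := by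
  have hmem : (u : ℂ) • annihilation (orb x 1) - (v : ℂ) • creation (orb x 0) ∈
      carSubalgebra (orbs ({x} : Finset Λ)) :=
    Subalgebra.sub_mem _
      (Subalgebra.smul_mem _ (annihilation_mem_carSubalgebra (orb_mem_orbs.2 (Finset.mem_singleton_self x))) _)
      (Subalgebra.smul_mem _ (creation_mem_carSubalgebra (orb_mem_orbs.2 (Finset.mem_singleton_self x))) _)
  rw [sum_onSiteBdG_comm_eq_single (fun y => (ξ y : ℂ)) (fun y => (D y : ℂ)) x hmem]
  exact bdgPair_comm_quasiparticleDown (orb_zero_ne_one' x) hu hv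

/-! ### Transport through an implementer -/

/-- Conjugation by an invertible pair transports commutators:
`(WHW')(WqW') - (WqW')(WHW') = W(Hq - qH)W'` for `W'W = 1`. [folklore] -/
private theorem conj_comm_conj {n : Type*} [Fintype n] [DecidableEq n] {W W' : Matrix n n ℂ}
    (h : W' * W = 1) (H q : Matrix n n ℂ) :
    W * H * W' * (W * q * W') - W * q * W' * (W * H * W') = W * (H * q - q * H) * W' := by
  rw [← conj_mul_of_mul_eq_one h, ← conj_mul_of_mul_eq_one h, Matrix.mul_sub, Matrix.sub_mul]

/-- Conjugation is linear on two-term combinations. [folklore] -/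
private theorem conj_smul_add_smul {n : Type*} [Fintype n] {W W' : Matrix n n ℂ} (c₁ c₂ : ℂ)
    (X Y : Matrix n n ℂ) : W * (c₁ • X + c₂ • Y) * W' = c₁ • (W * X * W') + c₂ • (W * Y * W') := by
  rw [Matrix.mul_add, Matrix.add_mul, Matrix.mul_smul, Matrix.smul_mul, Matrix.mul_smul, Matrix.smul_mul]

/-- Conjugation is linear on two-term differences. [folklore] -/
private theorem conj_smul_sub_smul {n : Type*} [Fintype n] {W W' : Matrix n n ℂ} (c₁ c₂ : ℂ)
    (X Y : Matrix n n ℂ) : W * (c₁ • X - c₂ • Y) * W' = c₁ • (W * X * W') - c₂ • (W * Y * W') := by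
  rw [Matrix.mul_sub, Matrix.sub_mul, Matrix.mul_smul, Matrix.smul_mul, Matrix.mul_smul, Matrix.smul_mul]

/-! ### The implementer conjugates the on-site blocks into `A` -/

/-- The Bogoliubov implementer of `exists_bdg_implementer`, together with the conjugation of the on-site BdG
blocks into `A = dWaveSourceTorus L 0 μ s` (the computation of `exists_conj_onSiteBdG_eq_dWaveSourceTorus`,
repeated for THIS implementer so that the one-body actions and the conjugation refer to the same `W`).
[cite: deGennes1966, Ch. 5] -/
private theorem exists_bdg_implementer_conj (hL : 3 ≤ L) (μ s : ℝ) :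
    ∃ W W' : Matrix (Finset (Orb (FermionTorus 2 L))) (Finset (Orb (FermionTorus 2 L))) ℂ,
      W' * W = 1 ∧ W * W' = 1 ∧
      (∀ x : FermionTorus 2 L, W * annihilation (orb x 0) * W' = momentumAnnihilation x.toTorusSite 0) ∧
      (∀ x : FermionTorus 2 L, W * annihilation (orb x 1) * W' = momentumAnnihilation (-x.toTorusSite) 1) ∧
      (∀ x : FermionTorus 2 L, W * creation (orb x 0) * W' = momentumCreation x.toTorusSite 0) ∧
      (∀ x : FermionTorus 2 L, W * creation (orb x 1) * W' = momentumCreation (-x.toTorusSite) 1) ∧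
      W * (∑ y : FermionTorus 2 L, (((torusBand L y.toTorusSite - μ : ℝ) : ℂ) • (numberOp y 0 + numberOp y 1) +
        ((2 * Real.sqrt 2 * s * dWaveGap y.toTorusSite : ℝ) : ℂ) •
          (annihilation (orb y 1) * annihilation (orb y 0) + (annihilation (orb y 1) * annihilation (orb y 0))ᴴ))) * W' = dWaveSourceTorus L 0 μ s := by
  obtain ⟨W, W', h1, h2, ha0, ha1, hc0, hc1⟩ := exists_bdg_implementer (L := L)
  refine ⟨W, W', h1, h2, ha0, ha1, hc0, hc1, ?_⟩
  have hnum : ∀ x : FermionTorus 2 L, W * (numberOp x 0 + numberOp x 1) * W' =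
      momentumNumber x.toTorusSite 0 + momentumNumber (-x.toTorusSite) 1 := by
    intro x
    rw [mul_add, add_mul, numberOp, numberOp, conj_mul_of_mul_eq_one h1, conj_mul_of_mul_eq_one h1,
      hc0, ha0, hc1, ha1, momentumNumber, momentumNumber]
  have hpair : ∀ x : FermionTorus 2 L,
      W * (annihilation (orb x 1) * annihilation (orb x 0) + (annihilation (orb x 1) * annihilation (orb x 0))ᴴ) * W' =
      pairMode x.toTorusSite + (pairMode x.toTorusSite)ᴴ := by
    intro x
    rw [pairMode_conjTranspose, pairMode, mul_add, add_mul, conjTranspose_mul, annihilation_conjTranspose,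
      annihilation_conjTranspose, conj_mul_of_mul_eq_one h1, conj_mul_of_mul_eq_one h1, ha1, ha0, hc0, hc1]
  have hsum : W * (∑ y : FermionTorus 2 L, (((torusBand L y.toTorusSite - μ : ℝ) : ℂ) • (numberOp y 0 + numberOp y 1) +
        ((2 * Real.sqrt 2 * s * dWaveGap y.toTorusSite : ℝ) : ℂ) •
          (annihilation (orb y 1) * annihilation (orb y 0) + (annihilation (orb y 1) * annihilation (orb y 0))ᴴ))) * W' = ∑ x : FermionTorus 2 L,
      (((torusBand L x.toTorusSite - μ : ℝ) : ℂ) • (momentumNumber x.toTorusSite 0 + momentumNumber (-x.toTorusSite) 1) +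
        ((2 * Real.sqrt 2 * s * dWaveGap x.toTorusSite : ℝ) : ℂ) • (pairMode x.toTorusSite + (pairMode x.toTorusSite)ᴴ)) := by
    rw [conj_sum_smul_add_smul]
    exact Finset.sum_congr rfl fun x _ => by rw [hnum, hpair]
  rw [hsum, dWaveSourceTorus_zero_eq_sum hL μ s]
  have hreidx : ∑ z : TorusSite 2 L, ((torusBand L z - μ : ℝ) : ℂ) • momentumNumber (-z) 1 =
      ∑ z : TorusSite 2 L, ((torusBand L z - μ : ℝ) : ℂ) • momentumNumber z 1 := by
    rw [← Equiv.sum_comp (Equiv.neg (TorusSite 2 L))]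
    refine Finset.sum_congr rfl fun z _ => ?_
    simp only [Equiv.neg_apply, neg_neg, torusBand_neg]
  rw [FermionTorus.sum_eq_sum_torusSite]
  simp only [FermionTorus.toTorusSite_ofTorusSite, smul_add, Finset.sum_add_distrib, hreidx]

/-! ### The momentum-space quasiparticles are lowering modes of `A` -/

/-- **`[A, γ⁽¹⁾_k] = -E_k γ⁽¹⁾_k`** for `A = dWaveSourceTorus L 0 μ s` (`L ≥ 3`) and
`γ⁽¹⁾_k = u c_{k↑} + v c†_{-k↓}`, under the Bogoliubov relations at `k`
(`D_k v = (E - ξ_k)u`, `D_k u = (E + ξ_k)v`, `ξ_k = ε_L(k) - μ`, `D_k = 2√2 s ĝ_d(k)`): the on-site relation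
`sum_onSiteBdG_comm_quasiparticleUp` transported through the implementer.
[cite: VondelftRalph2001, §4.2] [cite: deGennes1966, Ch. 5] -/
theorem dWaveSourceTorus_zero_comm_bdgModeUp (hL : 3 ≤ L) (μ s : ℝ) (k : TorusSite 2 L) {E u v : ℝ}
    (hu : 2 * Real.sqrt 2 * s * dWaveGap k * v = (E - (torusBand L k - μ)) * u)
    (hv : 2 * Real.sqrt 2 * s * dWaveGap k * u = (E + (torusBand L k - μ)) * v) :
    dWaveSourceTorus L 0 μ s * ((u : ℂ) • momentumAnnihilation k 0 + (v : ℂ) • momentumCreation (-k) 1) -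
        ((u : ℂ) • momentumAnnihilation k 0 + (v : ℂ) • momentumCreation (-k) 1) * dWaveSourceTorus L 0 μ s =
      -((E : ℂ) • ((u : ℂ) • momentumAnnihilation k 0 + (v : ℂ) • momentumCreation (-k) 1)) := by
  obtain ⟨W, W', h1, -, ha0, -, -, hc1, hconjH⟩ := exists_bdg_implementer_conj hL μ s
  set x : FermionTorus 2 L := FermionTorus.ofTorusSite k with hx
  have hk : x.toTorusSite = k := by rw [hx, FermionTorus.toTorusSite_ofTorusSite]
  have hq : W * ((u : ℂ) • annihilation (orb x 0) + (v : ℂ) • creation (orb x 1)) * W' =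
      (u : ℂ) • momentumAnnihilation k 0 + (v : ℂ) • momentumCreation (-k) 1 := by
    rw [conj_smul_add_smul, ha0, hc1, hk]
  have hb := sum_onSiteBdG_comm_quasiparticleUp (fun y : FermionTorus 2 L => torusBand L y.toTorusSite - μ)
    (fun y : FermionTorus 2 L => 2 * Real.sqrt 2 * s * dWaveGap y.toTorusSite) x
    (E := E) (u := u) (v := v) (by simpa only [hk] using hu) (by simpa only [hk] using hv)
  rw [← hconjH, ← hq, conj_comm_conj h1, hb, Matrix.mul_smul, Matrix.smul_mul, neg_smul]

/-- **`[A, γ⁽²⁾_k] = -E_k γ⁽²⁾_k`** for `γ⁽²⁾_k = u c_{-k↓} - v c†_{k↑}`, under the same relations.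
[cite: VondelftRalph2001, §4.2] [cite: deGennes1966, Ch. 5] -/
theorem dWaveSourceTorus_zero_comm_bdgModeDown (hL : 3 ≤ L) (μ s : ℝ) (k : TorusSite 2 L) {E u v : ℝ}
    (hu : 2 * Real.sqrt 2 * s * dWaveGap k * v = (E - (torusBand L k - μ)) * u)
    (hv : 2 * Real.sqrt 2 * s * dWaveGap k * u = (E + (torusBand L k - μ)) * v) :
    dWaveSourceTorus L 0 μ s * ((u : ℂ) • momentumAnnihilation (-k) 1 - (v : ℂ) • momentumCreation k 0) -
        ((u : ℂ) • momentumAnnihilation (-k) 1 - (v : ℂ) • momentumCreation k 0) * dWaveSourceTorus L 0 μ s =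
      -((E : ℂ) • ((u : ℂ) • momentumAnnihilation (-k) 1 - (v : ℂ) • momentumCreation k 0)) := by
  obtain ⟨W, W', h1, -, -, ha1, hc0, -, hconjH⟩ := exists_bdg_implementer_conj hL μ s
  set x : FermionTorus 2 L := FermionTorus.ofTorusSite k with hx
  have hk : x.toTorusSite = k := by rw [hx, FermionTorus.toTorusSite_ofTorusSite]
  have hq : W * ((u : ℂ) • annihilation (orb x 1) - (v : ℂ) • creation (orb x 0)) * W' =
      (u : ℂ) • momentumAnnihilation (-k) 1 - (v : ℂ) • momentumCreation k 0 := by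
    rw [conj_smul_sub_smul, ha1, hc0, hk]
  have hb := sum_onSiteBdG_comm_quasiparticleDown (fun y : FermionTorus 2 L => torusBand L y.toTorusSite - μ)
    (fun y : FermionTorus 2 L => 2 * Real.sqrt 2 * s * dWaveGap y.toTorusSite) x
    (E := E) (u := u) (v := v) (by simpa only [hk] using hu) (by simpa only [hk] using hv)
  rw [← hconjH, ← hq, conj_comm_conj h1, hb, Matrix.mul_smul, Matrix.smul_mul, neg_smul]

/-! ### The main theorem -/

/-- **At `U = 0` the Bogoliubov KKT rows pin the sourced pair amplitude.** Let `L ≥ 3`, `μ, s` real, and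
let `(u_k, v_k, E_k)` be Bogoliubov data for `ξ_k = ε_L(k) - μ`, `D_k = 2√2 s ĝ_d(k)`:
`u_k² + v_k² = 1`, `D_k v_k = (E_k - ξ_k)u_k`, `D_k u_k = (E_k + ξ_k)v_k`, with NO zero mode (`E_k > 0`). If a
state `ρ ⪰ 0` satisfies the second-order stationarity rows
`0 ≤ Re Tr(ρ γᴴ(Aγ - γA))`, `A = dWaveSourceTorus L 0 μ s`, for the `2L²` momentum-space quasiparticles
`γ⁽¹⁾_k = u_k c_{k↑} + v_k c†_{-k↓}` and `γ⁽²⁾_k = u_k c_{-k↓} - v_k c†_{k↑}`, then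
`Tr(ρ Δ_d) = 2√2 (Σ_k ĝ_d(k) u_k v_k) · Tr ρ`. No energy datum is used.
[cite: VondelftRalph2001, §4.2] [cite: BachLiebSolovej1994, §2] [cite: AraujoEtAl2023, §3.2 Prop. 11] -/
theorem trace_pairField_of_bdgRows (hL : 3 ≤ L) (μ s : ℝ) (u v E : TorusSite 2 L → ℝ)
    (huv : ∀ k, u k ^ 2 + v k ^ 2 = 1)
    (hu : ∀ k, 2 * Real.sqrt 2 * s * dWaveGap k * v k = (E k - (torusBand L k - μ)) * u k)
    (hv : ∀ k, 2 * Real.sqrt 2 * s * dWaveGap k * u k = (E k + (torusBand L k - μ)) * v k)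
    (hE : ∀ k, 0 < E k)
    {ρ : Matrix (Finset (Orb (FermionTorus 2 L))) (Finset (Orb (FermionTorus 2 L))) ℂ} (hρ : ρ.PosSemidef)
    (hrow₁ : ∀ k : TorusSite 2 L, 0 ≤ (ρ * (((u k : ℂ) • momentumAnnihilation k 0 +
        (v k : ℂ) • momentumCreation (-k) 1)ᴴ *
      (dWaveSourceTorus L 0 μ s * ((u k : ℂ) • momentumAnnihilation k 0 + (v k : ℂ) • momentumCreation (-k) 1) -
        ((u k : ℂ) • momentumAnnihilation k 0 + (v k : ℂ) • momentumCreation (-k) 1) *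
          dWaveSourceTorus L 0 μ s))).trace.re)
    (hrow₂ : ∀ k : TorusSite 2 L, 0 ≤ (ρ * (((u k : ℂ) • momentumAnnihilation (-k) 1 -
        (v k : ℂ) • momentumCreation k 0)ᴴ *
      (dWaveSourceTorus L 0 μ s * ((u k : ℂ) • momentumAnnihilation (-k) 1 - (v k : ℂ) • momentumCreation k 0) -
        ((u k : ℂ) • momentumAnnihilation (-k) 1 - (v k : ℂ) • momentumCreation k 0) *
          dWaveSourceTorus L 0 μ s))).trace.re) :
    (ρ * pairField dWaveFormFactor L).trace =
      ((2 * Real.sqrt 2 * ∑ k : TorusSite 2 L, dWaveGap k * u k * v k : ℝ) : ℂ) * ρ.trace := by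
  obtain ⟨W, W', h1, h2, ha0, ha1, hc0, hc1, -⟩ := exists_bdg_implementer_conj hL μ s
  -- (2) the on-site quasiparticles and their images
  have hq₁ : ∀ x : FermionTorus 2 L, W * (((u x.toTorusSite : ℂ)) • annihilation (orb x 0) +
      ((v x.toTorusSite : ℂ)) • creation (orb x 1)) * W' =
      (u x.toTorusSite : ℂ) • momentumAnnihilation x.toTorusSite 0 +
        (v x.toTorusSite : ℂ) • momentumCreation (-x.toTorusSite) 1 := by
    intro x; rw [conj_smul_add_smul, ha0, hc1]
  have hq₁H : ∀ x : FermionTorus 2 L, W * (((u x.toTorusSite : ℂ)) • annihilation (orb x 0) +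
      ((v x.toTorusSite : ℂ)) • creation (orb x 1))ᴴ * W' =
      ((u x.toTorusSite : ℂ) • momentumAnnihilation x.toTorusSite 0 +
        (v x.toTorusSite : ℂ) • momentumCreation (-x.toTorusSite) 1)ᴴ := by
    intro x
    rw [quasiparticleUp_conjTranspose, conj_smul_add_smul, hc0, ha1, conjTranspose_add, conjTranspose_smul,
      conjTranspose_smul, momentumAnnihilation_conjTranspose, momentumCreation_conjTranspose]
    simp only [Complex.star_def, Complex.conj_ofReal]
  have hq₂ : ∀ x : FermionTorus 2 L, W * (((u x.toTorusSite : ℂ)) • annihilation (orb x 1) -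
      ((v x.toTorusSite : ℂ)) • creation (orb x 0)) * W' =
      (u x.toTorusSite : ℂ) • momentumAnnihilation (-x.toTorusSite) 1 -
        (v x.toTorusSite : ℂ) • momentumCreation x.toTorusSite 0 := by
    intro x; rw [conj_smul_sub_smul, ha1, hc0]
  have hq₂H : ∀ x : FermionTorus 2 L, W * (((u x.toTorusSite : ℂ)) • annihilation (orb x 1) -
      ((v x.toTorusSite : ℂ)) • creation (orb x 0))ᴴ * W' =
      ((u x.toTorusSite : ℂ) • momentumAnnihilation (-x.toTorusSite) 1 -
        (v x.toTorusSite : ℂ) • momentumCreation x.toTorusSite 0)ᴴ := by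
    intro x
    rw [quasiparticleDown_conjTranspose, conj_smul_sub_smul, hc1, ha0, conjTranspose_sub, conjTranspose_smul,
      conjTranspose_smul, momentumAnnihilation_conjTranspose, momentumCreation_conjTranspose]
    simp only [Complex.star_def, Complex.conj_ofReal]
  -- (4) lowering relations for the momentum-space modes
  have hlow₁ : ∀ k : TorusSite 2 L,
      dWaveSourceTorus L 0 μ s * ((u k : ℂ) • momentumAnnihilation k 0 + (v k : ℂ) • momentumCreation (-k) 1) -
        ((u k : ℂ) • momentumAnnihilation k 0 + (v k : ℂ) • momentumCreation (-k) 1) * dWaveSourceTorus L 0 μ s =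
      -((E k : ℂ) • ((u k : ℂ) • momentumAnnihilation k 0 + (v k : ℂ) • momentumCreation (-k) 1)) := fun k =>
    dWaveSourceTorus_zero_comm_bdgModeUp hL μ s k (hu k) (hv k)
  have hlow₂ : ∀ k : TorusSite 2 L,
      dWaveSourceTorus L 0 μ s * ((u k : ℂ) • momentumAnnihilation (-k) 1 - (v k : ℂ) • momentumCreation k 0) -
        ((u k : ℂ) • momentumAnnihilation (-k) 1 - (v k : ℂ) • momentumCreation k 0) * dWaveSourceTorus L 0 μ s =
      -((E k : ℂ) • ((u k : ℂ) • momentumAnnihilation (-k) 1 - (v k : ℂ) • momentumCreation k 0)) := fun k =>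
    dWaveSourceTorus_zero_comm_bdgModeDown hL μ s k (hu k) (hv k)
  -- (5) rows ⇒ annihilation of `ρ` by all modes
  have hann₁ : ∀ k : TorusSite 2 L,
      ((u k : ℂ) • momentumAnnihilation k 0 + (v k : ℂ) • momentumCreation (-k) 1) * ρ = 0 ∧
        ρ * ((u k : ℂ) • momentumAnnihilation k 0 + (v k : ℂ) • momentumCreation (-k) 1)ᴴ = 0 :=
    annihilate_of_rows (fun k => (u k : ℂ) • momentumAnnihilation k 0 + (v k : ℂ) • momentumCreation (-k) 1)
      E hρ hlow₁ hE hrow₁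
  have hann₂ : ∀ k : TorusSite 2 L,
      ((u k : ℂ) • momentumAnnihilation (-k) 1 - (v k : ℂ) • momentumCreation k 0) * ρ = 0 ∧
        ρ * ((u k : ℂ) • momentumAnnihilation (-k) 1 - (v k : ℂ) • momentumCreation k 0)ᴴ = 0 :=
    annihilate_of_rows (fun k => (u k : ℂ) • momentumAnnihilation (-k) 1 - (v k : ℂ) • momentumCreation k 0)
      E hρ hlow₂ hE hrow₂
  -- (6) the conjugated state `ρ' = W' ρ W` is annihilated by the on-site quasiparticles
  set ρ' : Matrix (Finset (Orb (FermionTorus 2 L))) (Finset (Orb (FermionTorus 2 L))) ℂ := W' * ρ * W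
    with hρ'
  have hback : ∀ X Y : Matrix (Finset (Orb (FermionTorus 2 L))) (Finset (Orb (FermionTorus 2 L))) ℂ,
      W * X * W' = Y → X = W' * Y * W := by
    intro X Y hXY
    rw [← hXY]
    calc X = (W' * W) * X * (W' * W) := by rw [h1, Matrix.one_mul, Matrix.mul_one]
      _ = W' * (W * X * W') * W := by simp only [Matrix.mul_assoc]
  have hkill : ∀ (q γ : Matrix (Finset (Orb (FermionTorus 2 L))) (Finset (Orb (FermionTorus 2 L))) ℂ),
      W * q * W' = γ → W * qᴴ * W' = γᴴ → γ * ρ = 0 ∧ ρ * γᴴ = 0 → q * ρ' = 0 ∧ ρ' * qᴴ = 0 := by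
    intro q γ hqγ hqγH hγ
    have hq' := hback q γ hqγ
    have hqH' := hback qᴴ γᴴ hqγH
    constructor
    · rw [hq', hρ']
      calc W' * γ * W * (W' * ρ * W) = W' * γ * (W * W') * ρ * W := by simp only [Matrix.mul_assoc]
        _ = W' * (γ * ρ) * W := by rw [h2]; simp only [Matrix.mul_assoc, Matrix.mul_one]
        _ = 0 := by rw [hγ.1, Matrix.mul_zero, Matrix.zero_mul]
    · rw [hqH', hρ']
      calc W' * ρ * W * (W' * γᴴ * W) = W' * ρ * (W * W') * γᴴ * W := by simp only [Matrix.mul_assoc]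
        _ = W' * (ρ * γᴴ) * W := by rw [h2]; simp only [Matrix.mul_assoc, Matrix.mul_one]
        _ = 0 := by rw [hγ.2, Matrix.mul_zero, Matrix.zero_mul]
  have htr' : ρ'.trace = ρ.trace := by
    rw [hρ', Matrix.trace_mul_cycle, h2, Matrix.one_mul]
  -- (7) the per-site pair amplitude in `ρ'`
  have hsite : ∀ x : FermionTorus 2 L,
      (ρ' * (annihilation (orb x 1) * annihilation (orb x 0))).trace =
        -((u x.toTorusSite : ℂ) * v x.toTorusSite) * ρ.trace := by
    intro x
    rw [← htr']
    exact trace_pair_of_annihilate (orb_zero_ne_one' x) (huv x.toTorusSite)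
      (hkill _ _ (hq₁ x) (hq₁H x) (hann₁ x.toTorusSite))
      (hkill _ _ (hq₂ x) (hq₂H x) (hann₂ x.toTorusSite))
  -- (8) `Tr(ρ b_k) = Tr(ρ' P_x)` and the assembly
  have hmode : ∀ k : TorusSite 2 L, (ρ * pairMode k).trace = -((u k : ℂ) * v k) * ρ.trace := by
    intro k
    have hPk : pairMode k = W * (annihilation (orb (FermionTorus.ofTorusSite k) 1) *
        annihilation (orb (FermionTorus.ofTorusSite k) 0)) * W' := by
      rw [pairMode, conj_mul_of_mul_eq_one h1, ha1, ha0, FermionTorus.toTorusSite_ofTorusSite]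
    have hcyc : (ρ * pairMode k).trace = (ρ' * (annihilation (orb (FermionTorus.ofTorusSite k) 1) *
        annihilation (orb (FermionTorus.ofTorusSite k) 0))).trace := by
      rw [hPk, hρ']
      calc (ρ * (W * (annihilation (orb (FermionTorus.ofTorusSite k) 1) *
              annihilation (orb (FermionTorus.ofTorusSite k) 0)) * W')).trace
          = (ρ * W * (annihilation (orb (FermionTorus.ofTorusSite k) 1) *
              annihilation (orb (FermionTorus.ofTorusSite k) 0)) * W').trace := by
            simp only [Matrix.mul_assoc]
        _ = (W' * (ρ * W * (annihilation (orb (FermionTorus.ofTorusSite k) 1) *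
              annihilation (orb (FermionTorus.ofTorusSite k) 0)))).trace := Matrix.trace_mul_comm _ _
        _ = (W' * ρ * W * (annihilation (orb (FermionTorus.ofTorusSite k) 1) *
              annihilation (orb (FermionTorus.ofTorusSite k) 0))).trace := by
            simp only [Matrix.mul_assoc]
    rw [hcyc, hsite, FermionTorus.toTorusSite_ofTorusSite]
  rw [pairField_dWave_eq_smul_pairOperator, pairOperator, Matrix.mul_neg, Matrix.trace_neg, Matrix.mul_smul,
    Matrix.trace_smul, Finset.mul_sum, Matrix.trace_sum]
  simp_rw [Matrix.mul_smul, Matrix.trace_smul, hmode, smul_eq_mul]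
  push_cast
  simp only [Finset.mul_sum, Finset.sum_mul, ← Finset.sum_neg_distrib]
  exact Finset.sum_congr rfl fun k _ => by ring

/-- **Row-feasible states and ground states agree on the pair amplitude (`U = 0`).** Under the hypotheses
of `trace_pairField_of_bdgRows`, every ground-supported density matrix `ρ₀` of `A = dWaveSourceTorus L 0 μ s`
(`ρ₀ ⪰ 0`, `Aρ₀ = E₀ρ₀`) satisfies the same rows (`trace_mul_conjTranspose_comm_mul_nonneg`), so for every
row-feasible `ρ ⪰ 0` with `Tr ρ = Tr ρ₀`: `Tr(ρ Δ_d) = Tr(ρ₀ Δ_d)` — the KKT-certified sourced pair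
amplitude is the exact free value. [cite: BachLiebSolovej1994, §2] [cite: AraujoEtAl2023, §3.2 Prop. 11] -/
theorem trace_pairField_of_bdgRows_eq_groundState (hL : 3 ≤ L) (μ s : ℝ) (u v E : TorusSite 2 L → ℝ)
    (huv : ∀ k, u k ^ 2 + v k ^ 2 = 1)
    (hu : ∀ k, 2 * Real.sqrt 2 * s * dWaveGap k * v k = (E k - (torusBand L k - μ)) * u k)
    (hv : ∀ k, 2 * Real.sqrt 2 * s * dWaveGap k * u k = (E k + (torusBand L k - μ)) * v k)
    (hE : ∀ k, 0 < E k)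
    {ρ ρ₀ : Matrix (Finset (Orb (FermionTorus 2 L))) (Finset (Orb (FermionTorus 2 L))) ℂ} (hρ : ρ.PosSemidef)
    (hrow₁ : ∀ k : TorusSite 2 L, 0 ≤ (ρ * (((u k : ℂ) • momentumAnnihilation k 0 +
        (v k : ℂ) • momentumCreation (-k) 1)ᴴ *
      (dWaveSourceTorus L 0 μ s * ((u k : ℂ) • momentumAnnihilation k 0 + (v k : ℂ) • momentumCreation (-k) 1) -
        ((u k : ℂ) • momentumAnnihilation k 0 + (v k : ℂ) • momentumCreation (-k) 1) *
          dWaveSourceTorus L 0 μ s))).trace.re)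
    (hrow₂ : ∀ k : TorusSite 2 L, 0 ≤ (ρ * (((u k : ℂ) • momentumAnnihilation (-k) 1 -
        (v k : ℂ) • momentumCreation k 0)ᴴ *
      (dWaveSourceTorus L 0 μ s * ((u k : ℂ) • momentumAnnihilation (-k) 1 - (v k : ℂ) • momentumCreation k 0) -
        ((u k : ℂ) • momentumAnnihilation (-k) 1 - (v k : ℂ) • momentumCreation k 0) *
          dWaveSourceTorus L 0 μ s))).trace.re)
    (hρ₀ : ρ₀.PosSemidef)
    (hAρ₀ : dWaveSourceTorus L 0 μ s * ρ₀ = ((dWaveSourceTorus L 0 μ s).groundEnergy : ℂ) • ρ₀)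
    (htr : ρ.trace = ρ₀.trace) :
    (ρ * pairField dWaveFormFactor L).trace = (ρ₀ * pairField dWaveFormFactor L).trace := by
  have hA : (dWaveSourceTorus L 0 μ s).IsHermitian :=
    dWaveSourceTorus_isHermitian L (isHermitian_hamiltonianWith _ 1 0 μ) s
  have h0₁ := fun k : TorusSite 2 L => (Complex.nonneg_iff.1 (trace_mul_conjTranspose_comm_mul_nonneg hA hρ₀ hAρ₀
    ((u k : ℂ) • momentumAnnihilation k 0 + (v k : ℂ) • momentumCreation (-k) 1))).1
  have h0₂ := fun k : TorusSite 2 L => (Complex.nonneg_iff.1 (trace_mul_conjTranspose_comm_mul_nonneg hA hρ₀ hAρ₀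
    ((u k : ℂ) • momentumAnnihilation (-k) 1 - (v k : ℂ) • momentumCreation k 0))).1
  rw [trace_pairField_of_bdgRows hL μ s u v E huv hu hv hE hρ hrow₁ hrow₂,
    trace_pairField_of_bdgRows hL μ s u v E huv hu hv hE hρ₀ h0₁ h0₂, htr]

/-! ### The exact free-gas response: `m_{free,L}(s)` in closed form -/

/-- **The `U = 0` sourced pair density from Bogoliubov data.** For `L ≥ 3` and Bogoliubov data as in
`trace_pairField_of_bdgRows` (no zero mode), the tree's finite-volume sourced `d`-wave pair density
`m_L(s) = Re ω_s(Δ_d)/L²` (tracial ground state of `dWaveSourceTorus L 0 μ s`) equals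
`2√2 (Σ_k ĝ_d(k) u_k v_k)/L²`: the tracial ground state is ground-supported (`Matrix.mul_groundProj`), hence
satisfies the rows. [cite: VondelftRalph2001, §4.2] [cite: BachLiebSolovej1994, §2] -/
theorem dWaveSourceDensity_zero_eq_of_bogoliubov (hL : 3 ≤ L) (μ s : ℝ) (u v E : TorusSite 2 L → ℝ)
    (huv : ∀ k, u k ^ 2 + v k ^ 2 = 1)
    (hu : ∀ k, 2 * Real.sqrt 2 * s * dWaveGap k * v k = (E k - (torusBand L k - μ)) * u k)
    (hv : ∀ k, 2 * Real.sqrt 2 * s * dWaveGap k * u k = (E k + (torusBand L k - μ)) * v k)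
    (hE : ∀ k, 0 < E k) :
    dWaveSourceDensity L 0 μ s = (2 * Real.sqrt 2 * ∑ k : TorusSite 2 L, dWaveGap k * u k * v k) / (L : ℝ) ^ 2 := by
  set A := dWaveSourceTorus L 0 μ s with hAdef
  have hA : A.IsHermitian := dWaveSourceTorus_isHermitian L (isHermitian_hamiltonianWith _ 1 0 μ) s
  have hP : A.groundProj.PosSemidef := Matrix.posSemidef_groundProj A
  have hAP : A * A.groundProj = (A.groundEnergy : ℂ) • A.groundProj := Matrix.mul_groundProj A
  have h0₁ := fun k : TorusSite 2 L => (Complex.nonneg_iff.1 (trace_mul_conjTranspose_comm_mul_nonneg hA hP hAP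
    ((u k : ℂ) • momentumAnnihilation k 0 + (v k : ℂ) • momentumCreation (-k) 1))).1
  have h0₂ := fun k : TorusSite 2 L => (Complex.nonneg_iff.1 (trace_mul_conjTranspose_comm_mul_nonneg hA hP hAP
    ((u k : ℂ) • momentumAnnihilation (-k) 1 - (v k : ℂ) • momentumCreation k 0))).1
  have htr := trace_pairField_of_bdgRows hL μ s u v E huv hu hv hE hP h0₁ h0₂
  have hne : A.groundProj.trace ≠ 0 := Matrix.trace_groundProj_ne_zero hA
  rw [dWaveSourceDensity, ← hAdef, Matrix.groundStateFunctional_apply, htr, ← mul_assoc, mul_comm _ ((_ : ℝ) : ℂ),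
    mul_assoc, inv_mul_cancel₀ hne, mul_one, Complex.ofReal_re]

/-- From the Bogoliubov relations: `u v = D/(2E)` (`u² + v² = 1`, `E ≠ 0`). [cite: VondelftRalph2001, §4.2] -/
private theorem uv_eq_of_bogoliubov {ξ D E u v : ℝ} (hn : u ^ 2 + v ^ 2 = 1) (hu : D * v = (E - ξ) * u)
    (hv : D * u = (E + ξ) * v) (hE : E ≠ 0) : u * v = D / (2 * E) := by
  have h : D * (u ^ 2 + v ^ 2) = 2 * E * (u * v) := by linear_combination u * hv + v * hu
  rw [hn, mul_one] at h
  field_simp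
  linarith

/-- **The exact free-gas `d`-wave response** (`U = 0`, `L ≥ 3`, no BdG zero mode):
`m_L(s) = L⁻² Σ_k 4 s ĝ_d(k)² / √((ε_L(k) - μ)² + 8 s² ĝ_d(k)²)` for the sourced pair density
`dWaveSourceDensity L 0 μ s` (convention of record `m_L = Re ω(Δ_d)/L²`). This is the BdG response that the
cell's kill kits use as the `U = 0` calibration, now a theorem in finite volume (from
`dWaveSourceDensity_zero_eq_of_bogoliubov`, `exists_bogoliubov_uv` and `uv = D/(2E)`).
[cite: VondelftRalph2001, §4.2] [cite: deGennes1966, Ch. 5] -/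
theorem dWaveSourceDensity_zero_eq (hL : 3 ≤ L) (μ s : ℝ)
    (hgap : ∀ k : TorusSite 2 L, 0 < (torusBand L k - μ) ^ 2 + 8 * s ^ 2 * dWaveGap k ^ 2) :
    dWaveSourceDensity L 0 μ s =
      (∑ k : TorusSite 2 L, 4 * s * dWaveGap k ^ 2 /
        Real.sqrt ((torusBand L k - μ) ^ 2 + 8 * s ^ 2 * dWaveGap k ^ 2)) / (L : ℝ) ^ 2 := by
  -- Bogoliubov data at every momentum
  have h8 : ∀ k : TorusSite 2 L, (torusBand L k - μ) ^ 2 + (2 * Real.sqrt 2 * s * dWaveGap k) ^ 2 =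
      (torusBand L k - μ) ^ 2 + 8 * s ^ 2 * dWaveGap k ^ 2 := by
    intro k
    have h2 : Real.sqrt 2 ^ 2 = 2 := Real.sq_sqrt (by norm_num)
    nlinarith [h2]
  set E : TorusSite 2 L → ℝ := fun k => Real.sqrt ((torusBand L k - μ) ^ 2 + 8 * s ^ 2 * dWaveGap k ^ 2)
    with hEdef
  have hEk : ∀ k, E k = Real.sqrt ((torusBand L k - μ) ^ 2 + (2 * Real.sqrt 2 * s * dWaveGap k) ^ 2) := by
    intro k; rw [hEdef, h8]
  have hEpos : ∀ k, 0 < E k := fun k => Real.sqrt_pos.2 (hgap k)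
  have hex := fun k : TorusSite 2 L => exists_bogoliubov_uv (torusBand L k - μ) (2 * Real.sqrt 2 * s * dWaveGap k)
    (hEk k)
  choose u v huv hu hv using hex
  rw [dWaveSourceDensity_zero_eq_of_bogoliubov hL μ s u v E huv hu hv hEpos, Finset.mul_sum]
  congr 1
  refine Finset.sum_congr rfl fun k _ => ?_
  have huvk : u k * v k = 2 * Real.sqrt 2 * s * dWaveGap k / (2 * E k) :=
    uv_eq_of_bogoliubov (huv k) (hu k) (hv k) (hEpos k).ne'
  have h2 : Real.sqrt 2 ^ 2 = 2 := Real.sq_sqrt (by norm_num)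
  have hE0 : E k ≠ 0 := (hEpos k).ne'
  rw [mul_assoc (dWaveGap k), huvk]
  change _ = 4 * s * dWaveGap k ^ 2 / E k
  rw [eq_div_iff hE0]
  calc 2 * Real.sqrt 2 * (dWaveGap k * (2 * Real.sqrt 2 * s * dWaveGap k / (2 * E k))) * E k
      = Real.sqrt 2 ^ 2 * (2 * s * dWaveGap k ^ 2) * (E k / E k) := by ring
    _ = 4 * s * dWaveGap k ^ 2 := by rw [h2, div_self hE0]; ring

/-! ### The zero-mode edge: rows only at momenta carrying the pair field -/

/-- **Zero-mode edge removed: rows only where `ĝ_d(k) ≠ 0`.** Same conclusion as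
`trace_pairField_of_bdgRows`, but the positivity `E_k > 0` and the two rows are required ONLY at momenta with
`ĝ_d(k) ≠ 0` — momenta on the nodal diagonals (`ĝ_d(k) = 0`, where the BdG energy may vanish) do not enter
`Δ_d` at all. For `s ≠ 0` this removes the no-zero-mode hypothesis entirely (`E_k² = ξ_k² + 8s²ĝ_d(k)² > 0`
whenever `ĝ_d(k) ≠ 0`): the relaxation value stays a POINT; only at `s = 0` (free Fermi sea, degenerate) is it an
interval. [cite: VondelftRalph2001, §4.2] [cite: BachLiebSolovej1994, §2] [cite: AraujoEtAl2023, §3.2 Prop. 11] -/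
theorem trace_pairField_of_bdgRows_of_dWaveGap (hL : 3 ≤ L) (μ s : ℝ) (u v E : TorusSite 2 L → ℝ)
    (huv : ∀ k, u k ^ 2 + v k ^ 2 = 1)
    (hu : ∀ k, 2 * Real.sqrt 2 * s * dWaveGap k * v k = (E k - (torusBand L k - μ)) * u k)
    (hv : ∀ k, 2 * Real.sqrt 2 * s * dWaveGap k * u k = (E k + (torusBand L k - μ)) * v k)
    (hE : ∀ k, dWaveGap k ≠ 0 → 0 < E k)
    {ρ : Matrix (Finset (Orb (FermionTorus 2 L))) (Finset (Orb (FermionTorus 2 L))) ℂ} (hρ : ρ.PosSemidef)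
    (hrow₁ : ∀ k : TorusSite 2 L, dWaveGap k ≠ 0 → 0 ≤ (ρ * (((u k : ℂ) • momentumAnnihilation k 0 +
        (v k : ℂ) • momentumCreation (-k) 1)ᴴ *
      (dWaveSourceTorus L 0 μ s * ((u k : ℂ) • momentumAnnihilation k 0 + (v k : ℂ) • momentumCreation (-k) 1) -
        ((u k : ℂ) • momentumAnnihilation k 0 + (v k : ℂ) • momentumCreation (-k) 1) *
          dWaveSourceTorus L 0 μ s))).trace.re)
    (hrow₂ : ∀ k : TorusSite 2 L, dWaveGap k ≠ 0 → 0 ≤ (ρ * (((u k : ℂ) • momentumAnnihilation (-k) 1 -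
        (v k : ℂ) • momentumCreation k 0)ᴴ *
      (dWaveSourceTorus L 0 μ s * ((u k : ℂ) • momentumAnnihilation (-k) 1 - (v k : ℂ) • momentumCreation k 0) -
        ((u k : ℂ) • momentumAnnihilation (-k) 1 - (v k : ℂ) • momentumCreation k 0) *
          dWaveSourceTorus L 0 μ s))).trace.re) :
    (ρ * pairField dWaveFormFactor L).trace =
      ((2 * Real.sqrt 2 * ∑ k : TorusSite 2 L, dWaveGap k * u k * v k : ℝ) : ℂ) * ρ.trace := by
  obtain ⟨W, W', h1, h2, ha0, ha1, hc0, hc1, -⟩ := exists_bdg_implementer_conj hL μ s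
  -- (2) the on-site quasiparticles and their images
  have hq₁ : ∀ x : FermionTorus 2 L, W * (((u x.toTorusSite : ℂ)) • annihilation (orb x 0) +
      ((v x.toTorusSite : ℂ)) • creation (orb x 1)) * W' =
      (u x.toTorusSite : ℂ) • momentumAnnihilation x.toTorusSite 0 +
        (v x.toTorusSite : ℂ) • momentumCreation (-x.toTorusSite) 1 := by
    intro x; rw [conj_smul_add_smul, ha0, hc1]
  have hq₁H : ∀ x : FermionTorus 2 L, W * (((u x.toTorusSite : ℂ)) • annihilation (orb x 0) +
      ((v x.toTorusSite : ℂ)) • creation (orb x 1))ᴴ * W' =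
      ((u x.toTorusSite : ℂ) • momentumAnnihilation x.toTorusSite 0 +
        (v x.toTorusSite : ℂ) • momentumCreation (-x.toTorusSite) 1)ᴴ := by
    intro x
    rw [quasiparticleUp_conjTranspose, conj_smul_add_smul, hc0, ha1, conjTranspose_add, conjTranspose_smul,
      conjTranspose_smul, momentumAnnihilation_conjTranspose, momentumCreation_conjTranspose]
    simp only [Complex.star_def, Complex.conj_ofReal]
  have hq₂ : ∀ x : FermionTorus 2 L, W * (((u x.toTorusSite : ℂ)) • annihilation (orb x 1) -
      ((v x.toTorusSite : ℂ)) • creation (orb x 0)) * W' =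
      (u x.toTorusSite : ℂ) • momentumAnnihilation (-x.toTorusSite) 1 -
        (v x.toTorusSite : ℂ) • momentumCreation x.toTorusSite 0 := by
    intro x; rw [conj_smul_sub_smul, ha1, hc0]
  have hq₂H : ∀ x : FermionTorus 2 L, W * (((u x.toTorusSite : ℂ)) • annihilation (orb x 1) -
      ((v x.toTorusSite : ℂ)) • creation (orb x 0))ᴴ * W' =
      ((u x.toTorusSite : ℂ) • momentumAnnihilation (-x.toTorusSite) 1 -
        (v x.toTorusSite : ℂ) • momentumCreation x.toTorusSite 0)ᴴ := by
    intro x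
    rw [quasiparticleDown_conjTranspose, conj_smul_sub_smul, hc1, ha0, conjTranspose_sub, conjTranspose_smul,
      conjTranspose_smul, momentumAnnihilation_conjTranspose, momentumCreation_conjTranspose]
    simp only [Complex.star_def, Complex.conj_ofReal]
  -- (4) lowering relations for the momentum-space modes
  have hlow₁ : ∀ k : TorusSite 2 L,
      dWaveSourceTorus L 0 μ s * ((u k : ℂ) • momentumAnnihilation k 0 + (v k : ℂ) • momentumCreation (-k) 1) -
        ((u k : ℂ) • momentumAnnihilation k 0 + (v k : ℂ) • momentumCreation (-k) 1) * dWaveSourceTorus L 0 μ s =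
      -((E k : ℂ) • ((u k : ℂ) • momentumAnnihilation k 0 + (v k : ℂ) • momentumCreation (-k) 1)) := fun k =>
    dWaveSourceTorus_zero_comm_bdgModeUp hL μ s k (hu k) (hv k)
  have hlow₂ : ∀ k : TorusSite 2 L,
      dWaveSourceTorus L 0 μ s * ((u k : ℂ) • momentumAnnihilation (-k) 1 - (v k : ℂ) • momentumCreation k 0) -
        ((u k : ℂ) • momentumAnnihilation (-k) 1 - (v k : ℂ) • momentumCreation k 0) * dWaveSourceTorus L 0 μ s =
      -((E k : ℂ) • ((u k : ℂ) • momentumAnnihilation (-k) 1 - (v k : ℂ) • momentumCreation k 0)) := fun k =>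
    dWaveSourceTorus_zero_comm_bdgModeDown hL μ s k (hu k) (hv k)
  -- (5) rows ⇒ annihilation of `ρ` by all modes
  have hann₁ : ∀ k : TorusSite 2 L, dWaveGap k ≠ 0 →
      ((u k : ℂ) • momentumAnnihilation k 0 + (v k : ℂ) • momentumCreation (-k) 1) * ρ = 0 ∧
        ρ * ((u k : ℂ) • momentumAnnihilation k 0 + (v k : ℂ) • momentumCreation (-k) 1)ᴴ = 0 := fun k hk =>
    annihilate_of_rows (fun k' : {k : TorusSite 2 L // dWaveGap k ≠ 0} =>
        (u k'.1 : ℂ) • momentumAnnihilation k'.1 0 + (v k'.1 : ℂ) • momentumCreation (-k'.1) 1)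
      (fun k' => E k'.1) hρ (fun k' => hlow₁ k'.1) (fun k' => hE k'.1 k'.2) (fun k' => hrow₁ k'.1 k'.2) ⟨k, hk⟩
  have hann₂ : ∀ k : TorusSite 2 L, dWaveGap k ≠ 0 →
      ((u k : ℂ) • momentumAnnihilation (-k) 1 - (v k : ℂ) • momentumCreation k 0) * ρ = 0 ∧
        ρ * ((u k : ℂ) • momentumAnnihilation (-k) 1 - (v k : ℂ) • momentumCreation k 0)ᴴ = 0 := fun k hk =>
    annihilate_of_rows (fun k' : {k : TorusSite 2 L // dWaveGap k ≠ 0} =>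
        (u k'.1 : ℂ) • momentumAnnihilation (-k'.1) 1 - (v k'.1 : ℂ) • momentumCreation k'.1 0)
      (fun k' => E k'.1) hρ (fun k' => hlow₂ k'.1) (fun k' => hE k'.1 k'.2) (fun k' => hrow₂ k'.1 k'.2) ⟨k, hk⟩
  -- (6) the conjugated state `ρ' = W' ρ W` is annihilated by the on-site quasiparticles
  set ρ' : Matrix (Finset (Orb (FermionTorus 2 L))) (Finset (Orb (FermionTorus 2 L))) ℂ := W' * ρ * W
    with hρ'
  have hback : ∀ X Y : Matrix (Finset (Orb (FermionTorus 2 L))) (Finset (Orb (FermionTorus 2 L))) ℂ,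
      W * X * W' = Y → X = W' * Y * W := by
    intro X Y hXY
    rw [← hXY]
    calc X = (W' * W) * X * (W' * W) := by rw [h1, Matrix.one_mul, Matrix.mul_one]
      _ = W' * (W * X * W') * W := by simp only [Matrix.mul_assoc]
  have hkill : ∀ (q γ : Matrix (Finset (Orb (FermionTorus 2 L))) (Finset (Orb (FermionTorus 2 L))) ℂ),
      W * q * W' = γ → W * qᴴ * W' = γᴴ → γ * ρ = 0 ∧ ρ * γᴴ = 0 → q * ρ' = 0 ∧ ρ' * qᴴ = 0 := by
    intro q γ hqγ hqγH hγ
    have hq' := hback q γ hqγ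
    have hqH' := hback qᴴ γᴴ hqγH
    constructor
    · rw [hq', hρ']
      calc W' * γ * W * (W' * ρ * W) = W' * γ * (W * W') * ρ * W := by simp only [Matrix.mul_assoc]
        _ = W' * (γ * ρ) * W := by rw [h2]; simp only [Matrix.mul_assoc, Matrix.mul_one]
        _ = 0 := by rw [hγ.1, Matrix.mul_zero, Matrix.zero_mul]
    · rw [hqH', hρ']
      calc W' * ρ * W * (W' * γᴴ * W) = W' * ρ * (W * W') * γᴴ * W := by simp only [Matrix.mul_assoc]
        _ = W' * (ρ * γᴴ) * W := by rw [h2]; simp only [Matrix.mul_assoc, Matrix.mul_one]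
        _ = 0 := by rw [hγ.2, Matrix.mul_zero, Matrix.zero_mul]
  have htr' : ρ'.trace = ρ.trace := by
    rw [hρ', Matrix.trace_mul_cycle, h2, Matrix.one_mul]
  -- (7) the per-site pair amplitude in `ρ'`
  have hsite : ∀ x : FermionTorus 2 L, dWaveGap x.toTorusSite ≠ 0 →
      (ρ' * (annihilation (orb x 1) * annihilation (orb x 0))).trace =
        -((u x.toTorusSite : ℂ) * v x.toTorusSite) * ρ.trace := by
    intro x hx
    rw [← htr']
    exact trace_pair_of_annihilate (orb_zero_ne_one' x) (huv x.toTorusSite)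
      (hkill _ _ (hq₁ x) (hq₁H x) (hann₁ x.toTorusSite hx))
      (hkill _ _ (hq₂ x) (hq₂H x) (hann₂ x.toTorusSite hx))
  -- (8) `Tr(ρ b_k) = Tr(ρ' P_x)` and the assembly
  have hmode : ∀ k : TorusSite 2 L, dWaveGap k ≠ 0 →
      (ρ * pairMode k).trace = -((u k : ℂ) * v k) * ρ.trace := by
    intro k hk
    have hPk : pairMode k = W * (annihilation (orb (FermionTorus.ofTorusSite k) 1) *
        annihilation (orb (FermionTorus.ofTorusSite k) 0)) * W' := by
      rw [pairMode, conj_mul_of_mul_eq_one h1, ha1, ha0, FermionTorus.toTorusSite_ofTorusSite]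
    have hcyc : (ρ * pairMode k).trace = (ρ' * (annihilation (orb (FermionTorus.ofTorusSite k) 1) *
        annihilation (orb (FermionTorus.ofTorusSite k) 0))).trace := by
      rw [hPk, hρ']
      calc (ρ * (W * (annihilation (orb (FermionTorus.ofTorusSite k) 1) *
              annihilation (orb (FermionTorus.ofTorusSite k) 0)) * W')).trace
          = (ρ * W * (annihilation (orb (FermionTorus.ofTorusSite k) 1) *
              annihilation (orb (FermionTorus.ofTorusSite k) 0)) * W').trace := by
            simp only [Matrix.mul_assoc]
        _ = (W' * (ρ * W * (annihilation (orb (FermionTorus.ofTorusSite k) 1) *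
              annihilation (orb (FermionTorus.ofTorusSite k) 0)))).trace := Matrix.trace_mul_comm _ _
        _ = (W' * ρ * W * (annihilation (orb (FermionTorus.ofTorusSite k) 1) *
              annihilation (orb (FermionTorus.ofTorusSite k) 0))).trace := by
            simp only [Matrix.mul_assoc]
    rw [hcyc, hsite _ (by rwa [FermionTorus.toTorusSite_ofTorusSite]), FermionTorus.toTorusSite_ofTorusSite]
  rw [pairField_dWave_eq_smul_pairOperator, pairOperator, Matrix.mul_neg, Matrix.trace_neg, Matrix.mul_smul,
    Matrix.trace_smul, Finset.mul_sum, Matrix.trace_sum]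
  simp_rw [Matrix.mul_smul, Matrix.trace_smul, smul_eq_mul]
  have hsum : ∑ k : TorusSite 2 L, (dWaveGap k : ℂ) * (ρ * pairMode k).trace =
      ∑ k : TorusSite 2 L, (dWaveGap k : ℂ) * (-((u k : ℂ) * v k) * ρ.trace) := by
    refine Finset.sum_congr rfl fun k _ => ?_
    by_cases hk : dWaveGap k = 0
    · simp [hk]
    · rw [hmode k hk]
  rw [hsum]
  push_cast
  simp only [Finset.mul_sum, Finset.sum_mul, ← Finset.sum_neg_distrib]
  exact Finset.sum_congr rfl fun k _ => by ring

/-- **The exact free-gas `d`-wave response, unconditional for `s ≠ 0`** (`L ≥ 3`):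
`m_L(s) = L⁻² Σ_k 4 s ĝ_d(k)² / √((ε_L(k) - μ)² + 8 s² ĝ_d(k)²)` for `dWaveSourceDensity L 0 μ s`, with no
zero-mode hypothesis (nodal momenta contribute `0`). [cite: VondelftRalph2001, §4.2] [cite: deGennes1966, Ch. 5] -/
theorem dWaveSourceDensity_zero_eq_of_ne_zero (hL : 3 ≤ L) (μ : ℝ) {s : ℝ} (hs : s ≠ 0) :
    dWaveSourceDensity L 0 μ s =
      (∑ k : TorusSite 2 L, 4 * s * dWaveGap k ^ 2 /
        Real.sqrt ((torusBand L k - μ) ^ 2 + 8 * s ^ 2 * dWaveGap k ^ 2)) / (L : ℝ) ^ 2 := by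
  -- Bogoliubov data at every momentum
  have h8 : ∀ k : TorusSite 2 L, (torusBand L k - μ) ^ 2 + (2 * Real.sqrt 2 * s * dWaveGap k) ^ 2 =
      (torusBand L k - μ) ^ 2 + 8 * s ^ 2 * dWaveGap k ^ 2 := by
    intro k
    have h2 : Real.sqrt 2 ^ 2 = 2 := Real.sq_sqrt (by norm_num)
    nlinarith [h2]
  set E : TorusSite 2 L → ℝ := fun k => Real.sqrt ((torusBand L k - μ) ^ 2 + 8 * s ^ 2 * dWaveGap k ^ 2)
    with hEdef
  have hEk : ∀ k, E k = Real.sqrt ((torusBand L k - μ) ^ 2 + (2 * Real.sqrt 2 * s * dWaveGap k) ^ 2) := by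
    intro k; rw [hEdef, h8]
  have hEpos : ∀ k, dWaveGap k ≠ 0 → 0 < E k := by
    intro k hk
    apply Real.sqrt_pos.2
    have : 0 < s ^ 2 * dWaveGap k ^ 2 := by positivity
    nlinarith [sq_nonneg (torusBand L k - μ)]
  have hex := fun k : TorusSite 2 L => exists_bogoliubov_uv (torusBand L k - μ) (2 * Real.sqrt 2 * s * dWaveGap k)
    (hEk k)
  choose u v huv hu hv using hex
  -- the tracial ground state is ground-supported, hence satisfies all rows
  set A := dWaveSourceTorus L 0 μ s with hAdef
  have hA : A.IsHermitian := dWaveSourceTorus_isHermitian L (isHermitian_hamiltonianWith _ 1 0 μ) s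
  have hP : A.groundProj.PosSemidef := Matrix.posSemidef_groundProj A
  have hAP : A * A.groundProj = (A.groundEnergy : ℂ) • A.groundProj := Matrix.mul_groundProj A
  have h0₁ := fun (k : TorusSite 2 L) (_ : dWaveGap k ≠ 0) =>
    (Complex.nonneg_iff.1 (trace_mul_conjTranspose_comm_mul_nonneg hA hP hAP
      ((u k : ℂ) • momentumAnnihilation k 0 + (v k : ℂ) • momentumCreation (-k) 1))).1
  have h0₂ := fun (k : TorusSite 2 L) (_ : dWaveGap k ≠ 0) =>
    (Complex.nonneg_iff.1 (trace_mul_conjTranspose_comm_mul_nonneg hA hP hAP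
      ((u k : ℂ) • momentumAnnihilation (-k) 1 - (v k : ℂ) • momentumCreation k 0))).1
  have htr := trace_pairField_of_bdgRows_of_dWaveGap hL μ s u v E huv hu hv hEpos hP h0₁ h0₂
  have hne : A.groundProj.trace ≠ 0 := Matrix.trace_groundProj_ne_zero hA
  have hdens : dWaveSourceDensity L 0 μ s =
      (2 * Real.sqrt 2 * ∑ k : TorusSite 2 L, dWaveGap k * u k * v k) / (L : ℝ) ^ 2 := by
    rw [dWaveSourceDensity, ← hAdef, Matrix.groundStateFunctional_apply, htr, ← mul_assoc, mul_comm _ ((_ : ℝ) : ℂ),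
      mul_assoc, inv_mul_cancel₀ hne, mul_one, Complex.ofReal_re]
  rw [hdens, Finset.mul_sum]
  congr 1
  refine Finset.sum_congr rfl fun k _ => ?_
  by_cases hk : dWaveGap k = 0
  · simp [hk]
  have huvk : u k * v k = 2 * Real.sqrt 2 * s * dWaveGap k / (2 * E k) :=
    uv_eq_of_bogoliubov (huv k) (hu k) (hv k) (hEpos k hk).ne'
  have h2 : Real.sqrt 2 ^ 2 = 2 := Real.sq_sqrt (by norm_num)
  have hE0 : E k ≠ 0 := (hEpos k hk).ne'
  rw [mul_assoc (dWaveGap k), huvk]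
  change _ = 4 * s * dWaveGap k ^ 2 / E k
  rw [eq_div_iff hE0]
  calc 2 * Real.sqrt 2 * (dWaveGap k * (2 * Real.sqrt 2 * s * dWaveGap k / (2 * E k))) * E k
      = Real.sqrt 2 ^ 2 * (2 * s * dWaveGap k ^ 2) * (E k / E k) := by ring
    _ = 4 * s * dWaveGap k ^ 2 := by rw [h2, div_self hE0]; ring

end Literature.MathematicalPhysics.QuantumLattice
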